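import Literature.MeasureTheory.Group.DiscreteFundamentalDomain
import Mathlib.MeasureTheory.Group.FundamentalDomain
import Mathlib.Topology.Algebra.ConstMulAction

/-!
# Compact fundamental domains for discrete subgroups — preliminaries

Topic `MeasureTheory/Group`. Three ingredients of `DiscreteSubgroupCompactDomain` (compact fundamental
domains with non-empty interior and null boundary for cocompact discrete subgroups):

* §1 `isFundamentalDomain_of_exact_of_null` — a null enlargement of an EXACT fundamental domain (one
  containing exactly one point of every orbit) is a fundamental domain in Mathlib's a.e. sense
  (pure measure theory);
* §2 `closure_strictFundamentalDomain_diff_subset` — for the tree's construction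
  `strictFundamentalDomain Γ A = ⋃ i, strictPiece Γ A i` over finitely many OPEN local sets,
  `closure 𝓕 \ 𝓕 ⊆ ⋃ₙ frontier (A n)`; `subset_interior_closure_strictFundamentalDomain` (pure topology);
* §3 `localFamily` — a finite family of translates re-indexed by `ℕ` (then `∅`), with its induction
  principle.

Everything is proved (Mathlib + the tree file only).

## Provenance

Reproduced for the tree under the LEAN-IN-TREE rule (2026-08-18) from the pub-hodgecm cell's package file
`HodgeCM/PerL34/CompactDomain.lean` §§1–3 (DAG-node prover #09 lineage, seat pv09-g4, gate run 26; 486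
lines, split in two for the tree), verbatim up to: the namespace (`HodgeCM.PerL34.DiscreteFD` ↦
`Literature.MeasureTheory.Group.DiscreteSubgroup`); §2 re-pointed from the package's `piece` / `dom` to the
tree's `strictFundamentalDomain` (with the explicit `strictPiece`); added docstrings.
-/

set_option autoImplicit false

noncomputable section

open _root_.MeasureTheory Set _root_.Topology Filter Function
open scoped Pointwise ENNReal

namespace Literature.MeasureTheory.Group.DiscreteSubgroup

/-! ## §1 Null enlargements of exact fundamental domains -/

section NullEnlargement

variable {Γ : Type*} {X : Type*} [Group Γ] [MulAction Γ X] [MeasurableSpace X]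

omit [MeasurableSpace X] in
/-- Exactness forbids `γ • 𝓕₀` (`γ ≠ 1`) to meet `𝓕₀`. [folklore] -/
theorem disjoint_smul_of_existsUnique {𝓕₀ : Set X} (hex : ∀ x : X, ∃! γ : Γ, γ • x ∈ 𝓕₀)
    {γ : Γ} (hγ : γ ≠ 1) : Disjoint (γ • 𝓕₀) 𝓕₀ := by
  refine Set.disjoint_left.2 fun z hz hz₀ => hγ ?_
  obtain ⟨y, hy, rfl⟩ := mem_smul_set.1 hz
  obtain ⟨δ, -, huniq⟩ := hex y
  have h1 : (1 : Γ) = δ := huniq 1 (show (1 : Γ) • y ∈ 𝓕₀ by rwa [one_smul])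
  have h2 : γ = δ := huniq γ hz₀
  rw [h2, ← h1]

/-- **A null enlargement of an exact fundamental domain is a fundamental domain.**  If every orbit
meets `𝓕₀` exactly once, `𝓕₀ ⊆ 𝓕`, `𝓕` is null-measurable and `μ (𝓕 \ 𝓕₀) = 0`, then `𝓕` is a
fundamental domain for the (measurable, `μ`-preserving) action. [folklore] -/
theorem isFundamentalDomain_of_exact_of_null [MeasurableConstSMul Γ X] (μ : Measure X)
    [SMulInvariantMeasure Γ X μ] {𝓕₀ 𝓕 : Set X} (hex : ∀ x : X, ∃! γ : Γ, γ • x ∈ 𝓕₀)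
    (hsub : 𝓕₀ ⊆ 𝓕) (h𝓕 : NullMeasurableSet 𝓕 μ) (hnull : μ (𝓕 \ 𝓕₀) = 0) :
    IsFundamentalDomain Γ 𝓕 μ := by
  refine IsFundamentalDomain.mk'' h𝓕 (Eventually.of_forall fun x => ?_) (fun γ hγ => ?_)
    fun γ => (measurePreserving_smul γ μ).quasiMeasurePreserving
  · obtain ⟨γ, hγ, -⟩ := hex x
    exact ⟨γ, hsub hγ⟩
  · -- `γ • 𝓕 ∩ 𝓕 ⊆ γ • (𝓕 \ 𝓕₀) ∪ (𝓕 \ 𝓕₀)`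
    have hsub' : γ • 𝓕 ∩ 𝓕 ⊆ γ • (𝓕 \ 𝓕₀) ∪ (𝓕 \ 𝓕₀) := by
      rintro z ⟨hz, hz'⟩
      obtain ⟨y, hy, rfl⟩ := mem_smul_set.1 hz
      by_cases hy₀ : y ∈ 𝓕₀
      · by_cases hz₀ : γ • y ∈ 𝓕₀
        · exact absurd hz₀ (Set.disjoint_left.1 (disjoint_smul_of_existsUnique hex hγ)
            (smul_mem_smul_set hy₀))
        · exact Or.inr ⟨hz', hz₀⟩
      · exact Or.inl (smul_mem_smul_set ⟨hy, hy₀⟩)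
    refine measure_mono_null hsub' (measure_union_null ?_ hnull)
    rw [measure_smul]
    exact hnull

end NullEnlargement

/-! ## §2 The boundary of the construction `strictFundamentalDomain` over open local sets -/

section Boundary

variable {Γ : Type*} {X : Type*} [Group Γ] [MulAction Γ X]

variable (Γ) in
/-- The `i`-th piece of the tree's construction: `U i` minus the `Γ`-saturation of the earlier sets
(so that `strictFundamentalDomain Γ U = ⋃ i, strictPiece Γ U i` definitionally). [folklore] -/
def strictPiece (U : ℕ → Set X) (i : ℕ) : Set X :=
  U i \ ⋃ j < i, ⋃ γ : Γ, (fun x => γ⁻¹ • x) ⁻¹' U j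

/-- `strictFundamentalDomain` is the union of its pieces. [folklore] -/
theorem strictFundamentalDomain_eq_iUnion (U : ℕ → Set X) :
    strictFundamentalDomain Γ U = ⋃ i, strictPiece Γ U i := rfl

/-- Each piece lies in its local set. [folklore] -/
theorem strictPiece_subset (U : ℕ → Set X) (i : ℕ) : strictPiece Γ U i ⊆ U i := fun _ hx => hx.1

variable [TopologicalSpace X] [ContinuousConstSMul Γ X]

/-- A point of the closure of the `n`-th piece which is not in the domain lies on the frontier of
`A n` (the saturation of the earlier local sets is OPEN and misses the piece). [folklore] -/
theorem closure_strictPiece_diff_subset {A : ℕ → Set X} (hA : ∀ n, IsOpen (A n)) (n : ℕ) :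
    closure (strictPiece Γ A n) \ strictFundamentalDomain Γ A ⊆ frontier (A n) := by
  rintro y ⟨hyc, hyd⟩
  rw [strictFundamentalDomain_eq_iUnion] at hyd
  by_cases hyA : y ∈ A n
  · exfalso
    have hyT : y ∈ ⋃ j < n, ⋃ γ : Γ, (fun x => γ⁻¹ • x) ⁻¹' A j := by
      by_contra h
      exact hyd (mem_iUnion.2 ⟨n, show y ∈ strictPiece Γ A n from ⟨hyA, h⟩⟩)
    have hTo : IsOpen (⋃ j < n, ⋃ γ : Γ, (fun x => γ⁻¹ • x) ⁻¹' A j) :=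
      isOpen_iUnion fun m => isOpen_iUnion fun _ => isOpen_iUnion fun γ =>
        (hA m).preimage (continuous_const_smul _)
    obtain ⟨z, hzT, hzp⟩ := mem_closure_iff.1 hyc _ hTo hyT
    exact hzp.2 hzT
  · exact ⟨closure_mono (strictPiece_subset (Γ := Γ) A n) hyc, fun h => hyA (interior_subset h)⟩

/-- If only finitely many local sets are non-empty,
`closure 𝓕 \ 𝓕 ⊆ ⋃ₙ frontier (A n)` for `𝓕 = strictFundamentalDomain Γ A`. [folklore] -/
theorem closure_strictFundamentalDomain_diff_subset {A : ℕ → Set X} (hA : ∀ n, IsOpen (A n)) {N : ℕ}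
    (hN : ∀ n, N ≤ n → A n = ∅) :
    closure (strictFundamentalDomain Γ A) \ strictFundamentalDomain Γ A ⊆ ⋃ n, frontier (A n) := by
  classical
  have hdom : strictFundamentalDomain Γ A = ⋃ n ∈ Finset.range N, strictPiece Γ A n := by
    rw [strictFundamentalDomain_eq_iUnion]
    apply Subset.antisymm
    · rintro y hy
      obtain ⟨n, hn⟩ := mem_iUnion.1 hy
      have hnN : n < N := by
        by_contra h
        have := strictPiece_subset (Γ := Γ) A n hn
        rw [hN n (not_lt.1 h)] at this
        exact this
      exact mem_iUnion₂.2 ⟨n, Finset.mem_range.2 hnN, hn⟩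
    · rintro y hy
      obtain ⟨n, -, hn⟩ := mem_iUnion₂.1 hy
      exact mem_iUnion.2 ⟨n, hn⟩
  rintro y ⟨hyc, hyd⟩
  have hyc' : y ∈ closure (⋃ n ∈ Finset.range N, strictPiece Γ A n) := by rwa [← hdom]
  rw [Finset.closure_biUnion] at hyc'
  obtain ⟨n, -, hn⟩ := mem_iUnion₂.1 hyc'
  exact mem_iUnion.2 ⟨n, closure_strictPiece_diff_subset hA n ⟨hn, hyd⟩⟩

omit [ContinuousConstSMul Γ X] in
/-- The first local set lies in the interior of (the closure of) the domain. [folklore] -/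
theorem subset_interior_closure_strictFundamentalDomain {A : ℕ → Set X} (hA0 : IsOpen (A 0)) :
    A 0 ⊆ interior (closure (strictFundamentalDomain Γ A)) := by
  refine interior_maximal (fun y hy => subset_closure ?_) hA0
  rw [strictFundamentalDomain_eq_iUnion]
  refine mem_iUnion.2 ⟨0, show y ∈ strictPiece Γ A 0 from ⟨hy, ?_⟩⟩
  intro h
  obtain ⟨m, hm, -⟩ := mem_iUnion₂.1 h
  exact Nat.not_lt_zero m hm

end Boundary

/-! ## §3 Finite local families indexed by `ℕ` -/

section LocalFamily

variable {G : Type*}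

/-- The local family indexed by `ℕ`: the translates attached to an enumeration of a finset, then `∅`. [folklore] -/
def localFamily (t : Finset G) (V : G → Set G) (n : ℕ) : Set G :=
  if h : n < t.card then V ((t.equivFin.symm ⟨n, h⟩ : ↥t) : G) else ∅

/-- The local family below `t.card` is the enumerated translate. [folklore] -/
theorem localFamily_of_lt (t : Finset G) (V : G → Set G) {n : ℕ} (h : n < t.card) :
    localFamily t V n = V ((t.equivFin.symm ⟨n, h⟩ : ↥t) : G) := by
  simp [localFamily, h]

/-- The local family is `∅` from `t.card` on. [folklore] -/
theorem localFamily_of_le (t : Finset G) (V : G → Set G) {n : ℕ} (h : t.card ≤ n) :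
    localFamily t V n = ∅ := by
  simp [localFamily, not_lt.2 h]

/-- Every property of all `V x`, `x ∈ t`, which also holds for `∅`, holds for the local family. [folklore] -/
theorem localFamily_induction (t : Finset G) (V : G → Set G) {p : Set G → Prop} (h0 : p ∅)
    (hV : ∀ x ∈ t, p (V x)) (n : ℕ) : p (localFamily t V n) := by
  by_cases h : n < t.card
  · rw [localFamily_of_lt t V h]
    exact hV _ (t.equivFin.symm ⟨n, h⟩).2
  · rw [localFamily_of_le t V (not_lt.1 h)]
    exact h0

/-- Every `V x`, `x ∈ t`, occurs in the local family. [folklore] -/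
theorem exists_localFamily_eq (t : Finset G) (V : G → Set G) {x : G} (hx : x ∈ t) :
    ∃ n, localFamily t V n = V x := by
  obtain ⟨⟨n, hn⟩, hnx⟩ := t.equivFin.symm.surjective ⟨x, hx⟩
  refine ⟨n, ?_⟩
  rw [localFamily_of_lt t V hn, hnx]

/-- The local family is covered by the `V x`, `x ∈ t`. [folklore] -/
theorem localFamily_subset (t : Finset G) (V : G → Set G) (n : ℕ) :
    localFamily t V n ⊆ ⋃ x ∈ t, V x :=
  localFamily_induction t V (p := fun s => s ⊆ ⋃ x ∈ t, V x) (empty_subset _)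
    (fun _ hx => subset_biUnion_of_mem (u := fun x => V x) hx) n

end LocalFamily

end Literature.MeasureTheory.Group.DiscreteSubgroup
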